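import Summits.MatrixMultiplication.MatrixMultiplication.Theorems.ObstructionDescentUnitParity
import Summits.MatrixMultiplication.MatrixMultiplication.Theorems.ObstructionDescentBlockAction

set_option linter.dupNamespace false

/-!
# The unit-step law: odd levels die one triad above the unit tensor (decomp-mm · lens 3 · gen 14, Part G)

Route `route-MatrixMultiplication-ObstructionDescent`, support for the aside `InvariantSaturation` (item
`stmt-MatrixMultiplication-32282`); continues `ObstructionDescentLeviWeylLaw` (Levi–Weyl sign law, restriction to a
line, Laurent rigidity) and `ObstructionDescentUnitParity` (`GL_m³`-invariance of the level set at the first cell).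

**The law (hand law «unit-step» of NODE-g11, here made kernel in its elementary form).**  Let `k` be ODD with
`k + 2 ≤ m`, and let `f ∈ hwvSpace ((k^m),(k^m),(k^m)) d` be any weight vector of the rectangular type of level `k` at
the first cell `N = m`.  Then `f` vanishes at every STEP POINT
`stepPoint z = ⟨m⟩ + 𝟙 ⊗ 𝟙 ⊗ z` (`z ∈ ℂ^m`; a tensor of rank `≤ m + 1`), and hence — the level set at the first cell
being `GL_m³`-invariant (`pointLevels_self_actTensor`) — `k ∉ E'_m(x)` for every `x` in the `GL_m³`-orbit of a step
point (`not_mem_pointLevels_actTensor_stepPoint`).  These orbits sweep out the generic part of the `(m+1)`-st secant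
variety (every `Σ_{i<m} aᵢ⊗bᵢ⊗cᵢ + u⊗v⊗w` with three bases and `u`, `v` off the coordinate hyperplanes of the `a`- and
`b`-frames is such a point), so for `m = 5`, `k = 3` this is the kernel form of «the level-3 generator `H₅` of `5³`
vanishes on `σ₆(5³)`», i.e. of the lower bound `r₅(3) ≥ 7` of the census's occurrence rank (density itself is not
formalised here).

**Proof.**  `Q(μ) := f(⟨m⟩ + 𝟙⊗𝟙⊗z[c ↦ μ])` is a polynomial in the one coordinate `μ = z_c`
(`exists_polynomial_evalT_line`).  (1) COINCIDENCES KILL: if two coordinates of `z` agree, `z_i = z_j`, the step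
point is fixed by the simultaneous relabelling by the transposition `(i j)`, so `f` vanishes there by the odd-symmetry
law `evalT_eq_zero_of_oddSymmetry` (Levi–Weyl sign law, `k` odd); hence `Q(z_j) = 0` for every `j ≠ c`.
(2) DEGREE `≤ k` BY THE TORUS: the slot-2 torus element `D_λ = diag(1,…,λ@c,…,1)` acts on `f` by `λ^k` and maps the
step point with `z_c = λ⁻¹` to `⟨m⟩ + 𝟙⊗𝟙⊗z[c ↦ 1] + (λ − 1)·e_c⊗e_c⊗e_c`, a point moving on a LINE in `λ`; so
`λ^k Q(λ⁻¹)` is a polynomial in `λ`, which forces `deg Q ≤ k` (`natDegree_le_of_pow_mul_eval_inv`, Laurent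
reflection).  (3) If the coordinates of `z` are pairwise distinct, `Q` has the `m − 1 ≥ k + 1` distinct roots
`z_j (j ≠ c)` and degree `≤ k`, so `Q = 0` and `f(stepPoint z) = Q(z_c) = 0`; otherwise (1) applies directly.
All hypotheses inline; no proposition defined; no `sorry`; standard axioms.  Nothing here proves `ω = 2`.
[cite: BurgisserIkenmeyer2011, §3.1–3.2 (weight vectors as `B`-eigenvectors); BurgisserIkenmeyer2017, §5 (5.2),
Thm 5.3 (`E'(w)`); folklore: an alternating polynomial of degree `< m − 1` in each variable vanishes]
-/

noncomputable section

open scoped BigOperators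
open Finset

namespace Summit.MatrixMultiplication.MatrixMultiplication.Theorems.ObstructionCalculus

open Literature.Computability.AlgebraicComplexity (actTensor actTensor_actTensor actTensor_permMatrix_apply
  unitTensor unitTensor_apply)

section UnitStep

variable {m : ℕ}

/-! ### 1 · Laurent degree bound -/

/-- LAURENT DEGREE BOUND.  If `c^k · Q(c⁻¹)` agrees with a polynomial `R(c)` for every `c ≠ 0`, then `deg Q ≤ k`:
otherwise the reflection of `Q` equals `X^{deg Q − k}·R` and its constant coefficient, the leading coefficient of `Q`,
vanishes. [folklore] -/
theorem natDegree_le_of_pow_mul_eval_inv {Q R : Polynomial ℂ} {k : ℕ}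
    (h : ∀ c : ℂ, c ≠ 0 → c ^ k * Q.eval c⁻¹ = R.eval c) : Q.natDegree ≤ k := by
  classical
  by_contra hlt
  rw [not_le] at hlt
  set n := Q.natDegree with hn
  have hQ0 : Q ≠ 0 := by
    rintro rfl
    rw [Polynomial.natDegree_zero] at hn
    omega
  haveI : Infinite ℂ := Infinite.of_injective _ Nat.cast_injective
  have hrefl : Polynomial.reflect n Q = Polynomial.X ^ (n - k) * R := by
    refine Polynomial.eq_of_infinite_eval_eq _ _ ?_
    refine ((Set.finite_singleton (0 : ℂ)).infinite_compl).mono fun c hc => ?_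
    have hc : c ≠ 0 := by simpa only [Set.mem_compl_iff, Set.mem_singleton_iff] using hc
    letI : Invertible (c⁻¹) := invertibleOfNonzero (inv_ne_zero hc)
    have key : (Polynomial.reflect n Q).eval (⅟ (c⁻¹)) * c⁻¹ ^ n = Q.eval c⁻¹ :=
      Polynomial.eval₂_reflect_mul_pow (RingHom.id ℂ) c⁻¹ n Q (le_of_eq hn.symm)
    rw [invOf_eq_inv, inv_inv] at key
    have key' : (Polynomial.reflect n Q).eval c = c ^ n * Q.eval c⁻¹ := by
      have h2 : (Polynomial.reflect n Q).eval c * c⁻¹ ^ n * c ^ n = Q.eval c⁻¹ * c ^ n := by rw [key]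
      rwa [mul_assoc, ← mul_pow, inv_mul_cancel₀ hc, one_pow, mul_one, mul_comm (Q.eval c⁻¹)] at h2
    show (Polynomial.reflect n Q).eval c = (Polynomial.X ^ (n - k) * R).eval c
    rw [key', Polynomial.eval_mul, Polynomial.eval_pow, Polynomial.eval_X, ← h c hc, ← mul_assoc, ← pow_add,
      Nat.sub_add_cancel hlt.le]
  have h0 := congrArg (fun P : Polynomial ℂ => P.coeff 0) hrefl
  simp only [Polynomial.coeff_reflect, Polynomial.revAt_zero, Polynomial.coeff_X_pow_mul'] at h0
  rw [if_neg (by omega)] at h0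
  exact hQ0 (Polynomial.leadingCoeff_eq_zero.1 (by rw [Polynomial.leadingCoeff, ← hn]; exact h0))

/-! ### 2 · Step points and the two lines through them -/

/-- The STEP POINT `⟨m⟩ + 𝟙 ⊗ 𝟙 ⊗ z`: entries `δ_{a=b=c} + z_c` (rank `≤ m + 1`). [this node] -/
def stepPoint (z : Fin m → ℂ) : Tensor ℂ m := fun a b c => unitTensor ℂ m a b c + z c

/-- The direction `𝟙 ⊗ 𝟙 ⊗ e_c`. [bookkeeping] -/
def oneOneAt (c : Fin m) : Tensor ℂ m := fun _ _ c' => if c' = c then 1 else 0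

/-- The direction `e_c ⊗ e_c ⊗ e_c`. [bookkeeping] -/
def cubeAt (c : Fin m) : Tensor ℂ m := fun a b c' => if a = c ∧ b = c ∧ c' = c then 1 else 0

/-- Moving the coordinate `z_c` moves the step point along the line with direction `𝟙⊗𝟙⊗e_c`. [bookkeeping] -/
theorem stepPoint_update (z : Fin m → ℂ) (c : Fin m) (μ : ℂ) :
    stepPoint (Function.update z c μ) = stepPoint (Function.update z c 0) + μ • oneOneAt c := by
  funext a b c'
  simp only [stepPoint, oneOneAt, Pi.add_apply, Pi.smul_apply, smul_eq_mul, Function.update_apply]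
  split_ifs <;> ring

/-- One-slot action of a diagonal matrix in slot `2`, entrywise. [bookkeeping] -/
theorem slotAct_two_diagonal_apply (δ : Fin m → ℂ) (t : Tensor ℂ m) (a b c : Fin m) :
    slotAct 2 (Matrix.diagonal δ) t a b c = δ c * t a b c := by
  rw [slotAct_two_apply, Finset.sum_eq_single c]
  · rw [Matrix.diagonal_apply_eq]
  · intro x _ hx
    rw [Matrix.diagonal_apply_ne _ (Ne.symm hx), zero_mul]
  · intro h
    exact absurd (Finset.mem_univ c) h

/-- The slot-2 torus element `diag(1,…,λ@c,…,1)` maps the step point with `z_c = μ` to the step point with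
`z_c = λμ` translated by `(λ − 1)·e_c⊗e_c⊗e_c`. [this node] -/
theorem slotAct_two_torus_stepPoint (z : Fin m → ℂ) (c : Fin m) (l μ : ℂ) :
    slotAct 2 (Matrix.diagonal (Function.update (fun _ : Fin m => (1 : ℂ)) c l)) (stepPoint (Function.update z c μ))
      = stepPoint (Function.update z c (l * μ)) + (l - 1) • cubeAt c := by
  funext a b c'
  rw [slotAct_two_diagonal_apply]
  simp only [stepPoint, cubeAt, unitTensor_apply, Pi.add_apply, Pi.smul_apply, smul_eq_mul]
  by_cases hc : c' = c
  · subst hc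
    simp only [Function.update_self, and_true]
    have hcond : (a = b ∧ b = c') ↔ (a = c' ∧ b = c') :=
      ⟨fun h => ⟨h.1.trans h.2, h.2⟩, fun h => ⟨h.1.trans h.2.symm, h.2⟩⟩
    by_cases hab : a = c' ∧ b = c'
    · rw [if_pos (hcond.2 hab), if_pos hab]
      ring
    · rw [if_neg (fun h => hab (hcond.1 h)), if_neg hab]
      ring
  · simp only [Function.update_of_ne hc, hc, and_false, if_false]
    ring

/-- The exponent vector of the rectangular type at the first cell is constant `k`, so `diag(1,…,λ@c,…,1)` has character
value `λ^k`. [bookkeeping] -/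
theorem weightChar_rectType_self_torus (k : ℕ) (s : Fin 3) (c : Fin m) (l : ℂ) :
    weightChar (rectType m m k s) (Matrix.diagonal (Function.update (fun _ : Fin m => (1 : ℂ)) c l)) = l ^ k := by
  rw [weightChar_diagonal, Finset.prod_eq_single c]
  · rw [Function.update_self]
    unfold rectType
    rw [if_pos (Nat.le_add_left m _)]
  · intro i _ hi
    rw [Function.update_of_ne hi, one_pow]
  · intro h
    exact absurd (Finset.mem_univ c) h

/-! ### 3 · Coincidences kill (Levi–Weyl sign law) -/

/-- A step point two of whose coordinates agree is fixed by the simultaneous transposition of those two indices.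
[bookkeeping] -/
theorem actTensor_swap_stepPoint {z : Fin m → ℂ} {i j : Fin m} (h : z i = z j) :
    actTensor ((Equiv.swap i j).permMatrix ℂ) ((Equiv.swap i j).permMatrix ℂ) ((Equiv.swap i j).permMatrix ℂ)
      (stepPoint z) = stepPoint z := by
  funext a b c
  rw [actTensor_permMatrix_apply]
  simp only [stepPoint, unitTensor_apply, EmbeddingLike.apply_eq_iff_eq]
  congr 1
  rcases eq_or_ne c i with rfl | h1
  · rw [Equiv.swap_apply_left]; exact h.symm
  rcases eq_or_ne c j with rfl | h2
  · rw [Equiv.swap_apply_right]; exact h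
  rw [Equiv.swap_apply_of_ne_of_ne h1 h2]

/-- **Coincidences kill.**  An odd-level weight vector at the first cell vanishes at a step point with two equal
coordinates. [this node] -/
theorem evalT_stepPoint_eq_zero_of_eq {k d : ℕ} (hk : Odd k) {f : MvPolynomial (Idx m) ℂ}
    (hf : f ∈ hwvSpace (rectType m m k) d) {z : Fin m → ℂ} {i j : Fin m} (hij : i ≠ j) (h : z i = z j) :
    evalT (stepPoint z) f = 0 :=
  evalT_eq_zero_of_oddSymmetry hk hf (Equiv.swap i j) (fun a _ => Nat.le_add_left m a)
    (Equiv.Perm.sign_swap hij) (actTensor_swap_stepPoint h)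

/-! ### 4 · Degree ≤ k by the torus -/

/-- **Degree bound.**  Along the coordinate line `μ ↦ ⟨m⟩ + 𝟙⊗𝟙⊗z[c ↦ μ]` a level-`k` weight vector at the first
cell is a polynomial of degree `≤ k` in `μ`. [this node] -/
theorem natDegree_stepPoint_line_le {k d : ℕ} {f : MvPolynomial (Idx m) ℂ} (hf : f ∈ hwvSpace (rectType m m k) d)
    (z : Fin m → ℂ) (c : Fin m) {Q : Polynomial ℂ}
    (hQ : ∀ μ : ℂ, evalT (stepPoint (Function.update z c μ)) f = Q.eval μ) : Q.natDegree ≤ k := by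
  obtain ⟨R, hR⟩ := exists_polynomial_evalT_line f (stepPoint (Function.update z c 1) - cubeAt c) (cubeAt c)
  refine natDegree_le_of_pow_mul_eval_inv (R := R) fun l hl => ?_
  have hD : Matrix.diagonal (Function.update (fun _ : Fin m => (1 : ℂ)) c l) ∈ borel m :=
    diagonal_mem_borel fun i => by
      rcases eq_or_ne i c with rfl | hi
      · rwa [Function.update_self]
      · rw [Function.update_of_ne hi]; exact one_ne_zero
  have h1 := evalT_slotAct hf hD (stepPoint (Function.update z c l⁻¹)) 2
  rw [weightChar_rectType_self_torus, slotAct_two_torus_stepPoint, mul_inv_cancel₀ hl, hQ] at h1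
  rw [← h1, ← hR l]
  congr 1
  rw [sub_smul, one_smul]
  abel

/-! ### 5 · The unit-step law -/

/-- **Unit-step law.**  For ODD `k` with `k + 2 ≤ m`, every weight vector of type `((k^m),(k^m),(k^m))` vanishes at
every step point `⟨m⟩ + 𝟙⊗𝟙⊗z`. [this node] -/
theorem evalT_stepPoint_eq_zero {k d : ℕ} (hk : Odd k) (hkm : k + 2 ≤ m) {f : MvPolynomial (Idx m) ℂ}
    (hf : f ∈ hwvSpace (rectType m m k) d) (z : Fin m → ℂ) : evalT (stepPoint z) f = 0 := by
  classical
  by_cases hz : Function.Injective z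
  · have hm : 0 < m := by omega
    set c : Fin m := ⟨0, hm⟩ with hc
    obtain ⟨Q, hQ⟩ := exists_polynomial_evalT_line f (stepPoint (Function.update z c 0)) (oneOneAt c)
    have hQz : ∀ μ : ℂ, evalT (stepPoint (Function.update z c μ)) f = Q.eval μ := fun μ => by
      rw [stepPoint_update, hQ]
    have hdeg : Q.natDegree ≤ k := natDegree_stepPoint_line_le hf z c hQz
    have hroot : ∀ j : Fin m, j ≠ c → Q.eval (z j) = 0 := fun j hj => by
      rw [← hQz]
      exact evalT_stepPoint_eq_zero_of_eq hk hf hj.symm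
        (by rw [Function.update_self, Function.update_of_ne hj])
    have hQ0 : Q = 0 := by
      refine Polynomial.eq_zero_of_natDegree_lt_card_of_eval_eq_zero' Q ((Finset.univ.erase c).image z)
        (fun i hi => ?_) ?_
      · obtain ⟨j, hj, rfl⟩ := Finset.mem_image.1 hi
        exact hroot j (Finset.ne_of_mem_erase hj)
      · rw [Finset.card_image_of_injective _ hz, Finset.card_erase_of_mem (Finset.mem_univ c),
          Finset.card_univ, Fintype.card_fin]
        omega
    have h := hQz (z c)
    rwa [Function.update_eq_self, hQ0, Polynomial.eval_zero] at h
  · simp only [Function.Injective, not_forall, exists_prop] at hz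
    obtain ⟨i, j, hzij, hij⟩ := hz
    exact evalT_stepPoint_eq_zero_of_eq hk hf hij hzij

/-- **Unit-step law for the level set.**  `k ∉ E'_m(⟨m⟩ + 𝟙⊗𝟙⊗z)` for odd `k ≤ m − 2`. [this node] -/
theorem not_mem_pointLevels_stepPoint {k : ℕ} (hk : Odd k) (hkm : k + 2 ≤ m) (z : Fin m → ℂ) :
    k ∉ pointLevels m (stepPoint z) := by
  rintro ⟨f, hf, hne⟩
  exact hne (evalT_stepPoint_eq_zero hk hkm hf z)

/-- … and for the whole `GL_m³`-orbit of every step point (a family whose union is dense in the `(m+1)`-st secant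
variety): for `m = 5`, `k = 3` the kernel form of «`H₅` vanishes on `σ₆(5³)`», i.e. `r₅(3) ≥ 7`. [this node] -/
theorem not_mem_pointLevels_actTensor_stepPoint {k : ℕ} (hk : Odd k) (hkm : k + 2 ≤ m)
    {A B C : Matrix (Fin m) (Fin m) ℂ} (hA : A.det ≠ 0) (hB : B.det ≠ 0) (hC : C.det ≠ 0) (z : Fin m → ℂ) :
    k ∉ pointLevels m (actTensor A B C (stepPoint z)) := by
  rw [pointLevels_self_actTensor hA hB hC]
  exact not_mem_pointLevels_stepPoint hk hkm z

end UnitStep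

end Summit.MatrixMultiplication.MatrixMultiplication.Theorems.ObstructionCalculus

end
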